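import Mathlib.Analysis.Calculus.ParametricIntegral
import Literature.Probability.LatticeModels.PlaneRotatorGinibreComparison
import Literature.Probability.LatticeModels.LayeredIsingMeanField
import Literature.MathematicalPhysics.QuantumFieldTheory.U1WeakCouplingD4SingleBeta
import HarnessLib

/-!
# The Aizenman–Simon local Ward identity for plane rotators and the mean-field bound on the
# transition temperature of the classical (layered) XY model: `⟨cos(θ_a − θ_c)⟩ ≤ ½ ∑_y J_{ay} ⟨cos(θ_y − θ_c)⟩`,
# hence exponential decay whenever `sup_a ∑_y βJ_{ay} < 2`; for the layered model on `ℤ³`,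
# `⟨cos(θ_a − θ_c)⟩_Λ ≤ (β(2J∥ + J⊥))^{|a−c|₁}` in every finite volume `Λ`

Topic `Literature/Probability/LatticeModels`. M. Aizenman, B. Simon, *Local Ward identities and the decay of
correlations in ferromagnets*, Comm. Math. Phys. 77 (1980) 137–143 [AizenmanSimon1980LocalWard]: for `N`-component
isotropically coupled pair ferromagnets `−H = ∑ J_{ik} σ_i·σ_k`, the local Ward identity (their (2.4),
`⟨Ȧ⟩ = β⟨A Ḣ⟩` for a one-parameter group of a-priori-measure-preserving maps) gives Theorem 3.1,
`⟨σ_i·σ_j⟩ ≤ (β/N) ∑_k J_{ik} ⟨σ_k·σ_j⟩` (`i ≠ j`), and Theorem 3.2, a mass gap (exponential decay of the two-point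
function) for every `β < [sup_i N⁻¹ ∑_k J_{ik}]⁻¹`, i.e. above the MEAN-FIELD transition temperature; Remark 4
there: any function satisfying the triangle inequality may replace `|i − j|`. For `N = 2` (plane rotators) on the
square lattice this is the bound `β_c ≥ 1/2` quoted in M. Aizenman, B. Simon, Phys. Lett. 76A (1980) 281
[AizenmanSimon1980RotorIsing] ("the mean field value 0.5, known to be a lower bound on `β_c^R`").

This file PROVES the `N = 2` case in the tree's Ginibre vocabulary (`GinibreModel.lean`: compact abelian group `Ω`,
Haar probability measure `μ`, continuous unitary characters `χₐ`, weights `exp(∑ Jₐ Re χₐ)`; XY specialisation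
`PlaneRotator.twoPoint` of `PlaneRotatorGinibreComparison.lean`: couplings `J : V × V → ℝ` on ORDERED pairs of a
finite vertex set, weight `exp(∑_{(x,y)} J(x,y) cos(θ_y − θ_x))`, inverse temperature absorbed in `J`):

* `ginibre_localWard` — **the local Ward identity** for a Ginibre model and a one-parameter family `u : ℝ → Ω`
  on which the characters are exponentials, `χₐ(u s) = e^{i kₐ s}`, `χ₀(u s) = e^{i k₀ s}`:
  `k₀ ∫ Re χ₀ · w dμ = ∑ₐ Jₐ kₐ ∫ Im χ₀ · Im χₐ · w dμ` (translation invariance of `μ` under `θ ↦ u(s)θ`,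
  differentiated at `s = 0` under the integral sign).
* `ginibreExpect_reChar_le_localWard` — with Griffiths' first inequality (`ginibreExpect_reChar_nonneg`, tree):
  `k₀ ⟨Re χ₀⟩ ≤ ½ ∑ₐ Jₐ (kₐ⁺ ⟨Re(χ₀ χₐ⁻¹)⟩ + kₐ⁻ ⟨Re(χ₀ χₐ)⟩)` for `J ≥ 0`.
* `PlaneRotator.twoPoint_le_half_sum_mul_twoPoint` — **Aizenman–Simon, Theorem 3.1 for `N = 2`**: for `J ≥ 0`
  and `a ≠ c`, `⟨cos(θ_a − θ_c)⟩ ≤ ½ ∑_y (J(a,y) + J(y,a)) ⟨cos(θ_y − θ_c)⟩` (rotation of the single spin `a`).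
* `PlaneRotator.twoPoint_le_pow_of_rowSum_le` — **Theorem 3.2 (mass gap above the mean-field temperature),
  finite-volume form**: if every symmetrised row sum `∑_y (J(a,y) + J(y,a)) ≤ 𝒥` and `d : V → ℕ` is `1`-Lipschitz
  along the bonds with `d c = 0`, then `⟨cos(θ_a − θ_c)⟩ ≤ (𝒥/2)^{d a}` — uniformly in the volume; informative
  exactly when `𝒥 < 2`, i.e. `β < 2/∑_y J_{ay}` = above the `N = 2` mean-field temperature.
* `PlaneRotator.twoPoint_nn_le_pow` — the isotropic nearest-neighbour model on any finite `Λ ⊂ ℤ^d`: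
  `⟨cos(θ_a − θ_c)⟩ ≤ (dβJ)^{|a−c|₁}`, i.e. `k_B T_c^{XY}(ℤ^d) ≤ d·J` (`d = 2`: `β_c ≥ 1/2`).
* `PlaneRotator.twoPoint_layered_le_pow` — **the layered XY model on `ℤ³`** (in-plane nearest-neighbour coupling
  `βJ∥`, inter-layer `βJ⊥`, the tree's `LongRangeIsing.layeredCoupling`, free boundary conditions on any finite
  `Λ ⊂ ℤ³`): `⟨cos(θ_a − θ_c)⟩_Λ ≤ (β(2J∥ + J⊥))^{|a − c|₁}`. Hence for `k_B T > 2J∥ + J⊥` the two-point function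
  decays exponentially with a volume-independent rate: **`k_B T_c^{XY}(J∥, J⊥) ≤ 2J∥ + J⊥`** in the only sense
  available in finite volume (the tree defines no `T_c` for rotators). The strictly two-dimensional case `J⊥ = 0`
  is `k_B T_BKT ≤ 2J` (`β_c ≥ 1/2` for `J = 1`).

Use (cell `pub/hubbard-tc`, MO-S3 ORDER → T_c back-end, ASSUMPTIONS.md §1 key K5 «XY-comparison», VERDICTS.md §3):
with `J∥ = J(0) = ρ̄_s/2` (certified flux-stiffness ceiling, tree units) and `J⊥ = J̄⊥` this is the MC-free,
Nelson–Kosterlitz-free ceiling `k_B T_c ≤ ρ̄_s·t + J̄⊥` of the K5-MF row — now a kernel theorem on the XY side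
(previously: Aizenman–Simon's rotor ≤ Ising comparison [thm-lit] × the Ising mean-field bound
`LayeredIsingMeanField.lean`). HONEST FRAMING: a theorem about the CLASSICAL layered XY model in finite volume; its
use for a material rests on the modelling key K5 (replace the superconducting layer by plane rotators whose
couplings are the certified `T = 0` pair-phase stiffness ceilings) — never certified.

Not here: the infinite-volume limit / a `T_c` object; the sharper Aizenman–Simon comparison `β_c^{rotor} ≥ 2β_c^{Ising}`
(Z₄ = Ising², Ginibre); `N ≥ 3`; quantum models.
-/

noncomputable section

open MeasureTheory Filter Finset
open scoped Topology BigOperators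

namespace Literature.Probability.LatticeModels

/-! ### Characters along a one-parameter family: `χ(u s) = e^{iks}` -/

section Characters

variable {Ω : Type*} [CommGroup Ω] [TopologicalSpace Ω]

/-- Addition formula for the imaginary part, `Im χ(φψ) = Im χ(φ) Re χ(ψ) + Re χ(φ) Im χ(ψ)` (`sin(a+b)`).
[folklore] -/
private theorem imChar_mul (χ : Ω →ₜ* Circle) (φ ψ : Ω) :
    imChar χ (φ * ψ) = imChar χ φ * reChar χ ψ + reChar χ φ * imChar χ ψ := by
  simp [reChar, imChar, map_mul, Circle.coe_mul, Complex.mul_im]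
  ring

/-- If `χ ω = e^{it}` then `Re χ(ω) = cos t`. [folklore] -/
private theorem reChar_of_eq_exp (χ : Ω →ₜ* Circle) {ω : Ω} {t : ℝ} (h : χ ω = Circle.exp t) : reChar χ ω = Real.cos t := by
  rw [reChar, h, Circle.coe_exp, Complex.exp_ofReal_mul_I_re]

/-- If `χ ω = e^{it}` then `Im χ(ω) = sin t`. [folklore] -/
private theorem imChar_of_eq_exp (χ : Ω →ₜ* Circle) {ω : Ω} {t : ℝ} (h : χ ω = Circle.exp t) : imChar χ ω = Real.sin t := by
  rw [imChar, h, Circle.coe_exp, Complex.exp_ofReal_mul_I_im]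

/-- Rotation of a character value: `χ ω = e^{it}` ⇒ `Re χ(ωθ) = cos t · Re χ(θ) − sin t · Im χ(θ)`. [folklore] -/
private theorem reChar_mul_of_eq_exp (χ : Ω →ₜ* Circle) {ω : Ω} {t : ℝ} (h : χ ω = Circle.exp t) (θ : Ω) :
    reChar χ (ω * θ) = Real.cos t * reChar χ θ - Real.sin t * imChar χ θ := by
  rw [reChar_mul, reChar_of_eq_exp χ h, imChar_of_eq_exp χ h]

/-- Rotation of a character value: `χ ω = e^{it}` ⇒ `Im χ(ωθ) = sin t · Re χ(θ) + cos t · Im χ(θ)`. [folklore] -/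
private theorem imChar_mul_of_eq_exp (χ : Ω →ₜ* Circle) {ω : Ω} {t : ℝ} (h : χ ω = Circle.exp t) (θ : Ω) :
    imChar χ (ω * θ) = Real.sin t * reChar χ θ + Real.cos t * imChar χ θ := by
  rw [imChar_mul, reChar_of_eq_exp χ h, imChar_of_eq_exp χ h]

/-- `(χ⁻¹) θ = (χ θ)⁻¹` for continuous characters. [folklore] -/
private theorem inv_charApply (χ : Ω →ₜ* Circle) (θ : Ω) : (χ⁻¹) θ = (χ θ)⁻¹ := rfl

/-- `2 Im χ₀ Im χ₁ = Re(χ₀ χ₁⁻¹) − Re(χ₀ χ₁)` (product-to-sum, `2 sin a sin b = cos(a−b) − cos(a+b)`). [folklore] -/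
private theorem two_mul_imChar_mul_imChar (χ₀ χ₁ : Ω →ₜ* Circle) (θ : Ω) :
    2 * (imChar χ₀ θ * imChar χ₁ θ) = reChar (χ₀ * χ₁⁻¹) θ - reChar (χ₀ * χ₁) θ := by
  have h1 : ((((χ₁ θ)⁻¹ : Circle) : ℂ)) = starRingEnd ℂ ((χ₁ θ : Circle) : ℂ) := Circle.coe_inv_eq_conj _
  simp only [reChar, imChar, ContinuousMonoidHom.mul_apply, inv_charApply, Circle.coe_mul, h1, Complex.mul_re,
    Complex.conj_re, Complex.conj_im]
  ring

end Characters

/-! ### The local Ward identity for Ginibre models -/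

section Integrand

variable {Ω : Type*} [CommGroup Ω] [TopologicalSpace Ω] {ι : Type*} [Fintype ι]

namespace LocalWard

/-! Explicit form of the rotated integrand `s ↦ Im χ₀(u(s)θ) · exp(∑ Jₐ Re χₐ(u(s)θ))` and its `s`-derivative. -/

variable (χ : ι → Ω →ₜ* Circle) (J : ι → ℝ) (χ₀ : Ω →ₜ* Circle) (k₀ : ℝ) (k : ι → ℝ)

/-- `A(s, θ) = sin(k₀s) Re χ₀(θ) + cos(k₀s) Im χ₀(θ)` (= `Im χ₀(u(s)θ)`). [folklore] -/
def obsA (s : ℝ) (θ : Ω) : ℝ :=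
  Real.sin (k₀ * s) * reChar χ₀ θ + Real.cos (k₀ * s) * imChar χ₀ θ

/-- `∂ₛ A(s, θ)`. [folklore] -/
def obsA' (s : ℝ) (θ : Ω) : ℝ :=
  k₀ * (Real.cos (k₀ * s) * reChar χ₀ θ - Real.sin (k₀ * s) * imChar χ₀ θ)

/-- `B(s, θ) = ∑ₐ Jₐ (cos(kₐ s) Re χₐ(θ) − sin(kₐ s) Im χₐ(θ))` (= the Hamiltonian at `u(s)θ`). [folklore] -/
def hamB (s : ℝ) (θ : Ω) : ℝ :=
  ∑ a, J a * (Real.cos (k a * s) * reChar (χ a) θ - Real.sin (k a * s) * imChar (χ a) θ)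

/-- `∂ₛ B(s, θ)`. [folklore] -/
def hamB' (s : ℝ) (θ : Ω) : ℝ :=
  ∑ a, J a * (-(k a) * (Real.sin (k a * s) * reChar (χ a) θ + Real.cos (k a * s) * imChar (χ a) θ))

/-- The rotated integrand `G(s, θ) = A(s, θ) exp B(s, θ)`. [folklore] -/
def obsG (s : ℝ) (θ : Ω) : ℝ :=
  obsA χ₀ k₀ s θ * Real.exp (hamB χ J k s θ)

/-- `∂ₛ G(s, θ)`. [folklore] -/
def obsG' (s : ℝ) (θ : Ω) : ℝ :=
  obsA' χ₀ k₀ s θ * Real.exp (hamB χ J k s θ) + obsA χ₀ k₀ s θ * (Real.exp (hamB χ J k s θ) * hamB' χ J k s θ)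

variable {χ J χ₀ k₀ k}

omit [TopologicalSpace Ω] in
/-- `s ↦ k s` has derivative `k`. [folklore] -/
private theorem hasDerivAt_const_mul_id (c s : ℝ) : HasDerivAt (fun x : ℝ => c * x) c s := by
  simpa using (hasDerivAt_id s).const_mul c

/-- `∂ₛ A = A'`. [folklore] -/
private theorem hasDerivAt_obsA (s : ℝ) (θ : Ω) : HasDerivAt (fun x => obsA χ₀ k₀ x θ) (obsA' χ₀ k₀ s θ) s := by
  have hks := hasDerivAt_const_mul_id k₀ s
  have hsin := (Real.hasDerivAt_sin (k₀ * s)).comp s hks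
  have hcos := (Real.hasDerivAt_cos (k₀ * s)).comp s hks
  have h := (hsin.mul_const (reChar χ₀ θ)).add (hcos.mul_const (imChar χ₀ θ))
  have e : Real.cos (k₀ * s) * k₀ * reChar χ₀ θ + -Real.sin (k₀ * s) * k₀ * imChar χ₀ θ = obsA' χ₀ k₀ s θ := by
    unfold obsA'; ring
  rw [← e]
  exact h

/-- `∂ₛ B = B'`. [folklore] -/
private theorem hasDerivAt_hamB (s : ℝ) (θ : Ω) : HasDerivAt (fun x => hamB χ J k x θ) (hamB' χ J k s θ) s := by
  have hterm : ∀ a ∈ (Finset.univ : Finset ι), HasDerivAt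
      (fun x => J a * (Real.cos (k a * x) * reChar (χ a) θ - Real.sin (k a * x) * imChar (χ a) θ))
      (J a * (-(k a) * (Real.sin (k a * s) * reChar (χ a) θ + Real.cos (k a * s) * imChar (χ a) θ))) s := by
    intro a _
    have hks := hasDerivAt_const_mul_id (k a) s
    have hsin := (Real.hasDerivAt_sin (k a * s)).comp s hks
    have hcos := (Real.hasDerivAt_cos (k a * s)).comp s hks
    have h := ((hcos.mul_const (reChar (χ a) θ)).sub (hsin.mul_const (imChar (χ a) θ))).const_mul (J a)
    have e : J a * (-Real.sin (k a * s) * k a * reChar (χ a) θ - Real.cos (k a * s) * k a * imChar (χ a) θ) =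
        J a * (-(k a) * (Real.sin (k a * s) * reChar (χ a) θ + Real.cos (k a * s) * imChar (χ a) θ)) := by ring
    rw [← e]
    exact h
  have h := HasDerivAt.fun_sum hterm
  exact h

/-- `∂ₛ G = G'`. [folklore] -/
private theorem hasDerivAt_obsG (s : ℝ) (θ : Ω) : HasDerivAt (fun x => obsG χ J χ₀ k₀ k x θ) (obsG' χ J χ₀ k₀ k s θ) s :=
  (hasDerivAt_obsA s θ).mul (hasDerivAt_hamB s θ).exp

/-- `|A| ≤ 2`. [folklore] -/
private theorem abs_obsA_le (s : ℝ) (θ : Ω) : |obsA χ₀ k₀ s θ| ≤ 2 := by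
  unfold obsA
  have h1 := Real.abs_sin_le_one (k₀ * s)
  have h2 := Real.abs_cos_le_one (k₀ * s)
  have h3 := abs_reChar_le_one χ₀ θ
  have h4 := abs_imChar_le_one χ₀ θ
  calc |Real.sin (k₀ * s) * reChar χ₀ θ + Real.cos (k₀ * s) * imChar χ₀ θ|
      ≤ |Real.sin (k₀ * s) * reChar χ₀ θ| + |Real.cos (k₀ * s) * imChar χ₀ θ| := abs_add_le _ _
    _ = |Real.sin (k₀ * s)| * |reChar χ₀ θ| + |Real.cos (k₀ * s)| * |imChar χ₀ θ| := by rw [abs_mul, abs_mul]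
    _ ≤ 1 * 1 + 1 * 1 := by gcongr
    _ = 2 := by norm_num

/-- `|A'| ≤ 2|k₀|`. [folklore] -/
private theorem abs_obsA'_le (s : ℝ) (θ : Ω) : |obsA' χ₀ k₀ s θ| ≤ 2 * |k₀| := by
  unfold obsA'
  have h1 := Real.abs_sin_le_one (k₀ * s)
  have h2 := Real.abs_cos_le_one (k₀ * s)
  have h3 := abs_reChar_le_one χ₀ θ
  have h4 := abs_imChar_le_one χ₀ θ
  rw [abs_mul]
  have h : |Real.cos (k₀ * s) * reChar χ₀ θ - Real.sin (k₀ * s) * imChar χ₀ θ| ≤ 2 :=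
    calc |Real.cos (k₀ * s) * reChar χ₀ θ - Real.sin (k₀ * s) * imChar χ₀ θ|
        ≤ |Real.cos (k₀ * s) * reChar χ₀ θ| + |Real.sin (k₀ * s) * imChar χ₀ θ| := abs_sub _ _
      _ = |Real.cos (k₀ * s)| * |reChar χ₀ θ| + |Real.sin (k₀ * s)| * |imChar χ₀ θ| := by rw [abs_mul, abs_mul]
      _ ≤ 1 * 1 + 1 * 1 := by gcongr
      _ = 2 := by norm_num
  nlinarith [abs_nonneg k₀]

/-- `B ≤ 2 ∑ |Jₐ|`. [folklore] -/
private theorem hamB_le (s : ℝ) (θ : Ω) : hamB χ J k s θ ≤ 2 * ∑ a, |J a| := by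
  unfold hamB
  rw [Finset.mul_sum]
  refine Finset.sum_le_sum fun a _ => ?_
  have h1 := Real.abs_sin_le_one (k a * s)
  have h2 := Real.abs_cos_le_one (k a * s)
  have h3 := abs_reChar_le_one (χ a) θ
  have h4 := abs_imChar_le_one (χ a) θ
  have h : |Real.cos (k a * s) * reChar (χ a) θ - Real.sin (k a * s) * imChar (χ a) θ| ≤ 2 :=
    calc |Real.cos (k a * s) * reChar (χ a) θ - Real.sin (k a * s) * imChar (χ a) θ|
        ≤ |Real.cos (k a * s) * reChar (χ a) θ| + |Real.sin (k a * s) * imChar (χ a) θ| := abs_sub _ _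
      _ = |Real.cos (k a * s)| * |reChar (χ a) θ| + |Real.sin (k a * s)| * |imChar (χ a) θ| := by
          rw [abs_mul, abs_mul]
      _ ≤ 1 * 1 + 1 * 1 := by gcongr
      _ = 2 := by norm_num
  calc J a * (Real.cos (k a * s) * reChar (χ a) θ - Real.sin (k a * s) * imChar (χ a) θ)
      ≤ |J a * (Real.cos (k a * s) * reChar (χ a) θ - Real.sin (k a * s) * imChar (χ a) θ)| := le_abs_self _
    _ = |J a| * |Real.cos (k a * s) * reChar (χ a) θ - Real.sin (k a * s) * imChar (χ a) θ| := abs_mul _ _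
    _ ≤ |J a| * 2 := by gcongr
    _ = 2 * |J a| := by ring

/-- `|B'| ≤ 2 ∑ |Jₐ kₐ|`. [folklore] -/
private theorem abs_hamB'_le (s : ℝ) (θ : Ω) : |hamB' χ J k s θ| ≤ 2 * ∑ a, |J a * k a| := by
  unfold hamB'
  rw [Finset.mul_sum]
  refine (Finset.abs_sum_le_sum_abs _ _).trans (Finset.sum_le_sum fun a _ => ?_)
  have h1 := Real.abs_sin_le_one (k a * s)
  have h2 := Real.abs_cos_le_one (k a * s)
  have h3 := abs_reChar_le_one (χ a) θ
  have h4 := abs_imChar_le_one (χ a) θ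
  have h : |Real.sin (k a * s) * reChar (χ a) θ + Real.cos (k a * s) * imChar (χ a) θ| ≤ 2 :=
    calc |Real.sin (k a * s) * reChar (χ a) θ + Real.cos (k a * s) * imChar (χ a) θ|
        ≤ |Real.sin (k a * s) * reChar (χ a) θ| + |Real.cos (k a * s) * imChar (χ a) θ| := abs_add_le _ _
      _ = |Real.sin (k a * s)| * |reChar (χ a) θ| + |Real.cos (k a * s)| * |imChar (χ a) θ| := by
          rw [abs_mul, abs_mul]
      _ ≤ 1 * 1 + 1 * 1 := by gcongr
      _ = 2 := by norm_num
  rw [show J a * (-(k a) * (Real.sin (k a * s) * reChar (χ a) θ + Real.cos (k a * s) * imChar (χ a) θ)) =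
      -(J a * k a) * (Real.sin (k a * s) * reChar (χ a) θ + Real.cos (k a * s) * imChar (χ a) θ) by ring,
    abs_mul, abs_neg]
  calc |J a * k a| * |Real.sin (k a * s) * reChar (χ a) θ + Real.cos (k a * s) * imChar (χ a) θ|
      ≤ |J a * k a| * 2 := by gcongr
    _ = 2 * |J a * k a| := by ring

/-- The uniform bound on the `s`-derivative:
`|G'| ≤ (2|k₀| + 4 ∑ |Jₐ kₐ|) exp(2 ∑ |Jₐ|)`. [folklore] -/
private theorem abs_obsG'_le (s : ℝ) (θ : Ω) :
    |obsG' χ J χ₀ k₀ k s θ| ≤ (2 * |k₀| + 4 * ∑ a, |J a * k a|) * Real.exp (2 * ∑ a, |J a|) := by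
  unfold obsG'
  have hE : Real.exp (hamB χ J k s θ) ≤ Real.exp (2 * ∑ a, |J a|) := Real.exp_le_exp.2 (hamB_le s θ)
  have hE0 : 0 < Real.exp (hamB χ J k s θ) := Real.exp_pos _
  have hA := abs_obsA_le (χ₀ := χ₀) (k₀ := k₀) s θ
  have hA' := abs_obsA'_le (χ₀ := χ₀) (k₀ := k₀) s θ
  have hB' := abs_hamB'_le (χ := χ) (J := J) (k := k) s θ
  calc |obsA' χ₀ k₀ s θ * Real.exp (hamB χ J k s θ) +
        obsA χ₀ k₀ s θ * (Real.exp (hamB χ J k s θ) * hamB' χ J k s θ)|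
      ≤ |obsA' χ₀ k₀ s θ * Real.exp (hamB χ J k s θ)| +
        |obsA χ₀ k₀ s θ * (Real.exp (hamB χ J k s θ) * hamB' χ J k s θ)| := abs_add_le _ _
    _ = |obsA' χ₀ k₀ s θ| * Real.exp (hamB χ J k s θ) +
        |obsA χ₀ k₀ s θ| * (Real.exp (hamB χ J k s θ) * |hamB' χ J k s θ|) := by
          rw [abs_mul, abs_mul, abs_mul, abs_of_pos hE0]
    _ ≤ 2 * |k₀| * Real.exp (2 * ∑ a, |J a|) + 2 * (Real.exp (2 * ∑ a, |J a|) * (2 * ∑ a, |J a * k a|)) := by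
          gcongr
    _ = (2 * |k₀| + 4 * ∑ a, |J a * k a|) * Real.exp (2 * ∑ a, |J a|) := by ring

/-- `G(s, ·)` is continuous. [folklore] -/
private theorem continuous_obsG (s : ℝ) : Continuous fun θ : Ω => obsG χ J χ₀ k₀ k s θ := by
  unfold obsG obsA hamB
  have := fun a => continuous_reChar (χ a)
  have := fun a => continuous_imChar (χ a)
  have := continuous_reChar χ₀
  have := continuous_imChar χ₀
  fun_prop

/-- `G'(s, ·)` is continuous. [folklore] -/
private theorem continuous_obsG' (s : ℝ) : Continuous fun θ : Ω => obsG' χ J χ₀ k₀ k s θ := by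
  unfold obsG' obsA obsA' hamB hamB'
  have := fun a => continuous_reChar (χ a)
  have := fun a => continuous_imChar (χ a)
  have := continuous_reChar χ₀
  have := continuous_imChar χ₀
  fun_prop

/-- At `s = 0`: `G(0, θ) = Im χ₀(θ) · w(θ)`. [folklore] -/
private theorem obsG_zero (θ : Ω) : obsG χ J χ₀ k₀ k 0 θ = imChar χ₀ θ * ginibreWeight χ J θ := by
  simp [obsG, obsA, hamB, ginibreWeight, ginibreHamiltonian]

/-- At `s = 0`: `G'(0, θ) = k₀ Re χ₀(θ) w(θ) − Im χ₀(θ) w(θ) ∑ₐ Jₐ kₐ Im χₐ(θ)`. [folklore] -/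
private theorem obsG'_zero (θ : Ω) : obsG' χ J χ₀ k₀ k 0 θ =
    k₀ * (reChar χ₀ θ * ginibreWeight χ J θ) -
      ∑ a, J a * k a * (imChar χ₀ θ * imChar (χ a) θ * ginibreWeight χ J θ) := by
  have hB : hamB χ J k 0 θ = ginibreHamiltonian χ J θ := by simp [hamB, ginibreHamiltonian]
  have hA : obsA χ₀ k₀ 0 θ = imChar χ₀ θ := by simp [obsA]
  have hA' : obsA' χ₀ k₀ 0 θ = k₀ * reChar χ₀ θ := by simp [obsA']
  have hB' : hamB' χ J k 0 θ = -∑ a, J a * k a * imChar (χ a) θ := by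
    simp only [hamB', mul_zero, Real.sin_zero, Real.cos_zero, zero_mul, one_mul, zero_add]
    rw [← Finset.sum_neg_distrib]
    exact Finset.sum_congr rfl fun a _ => by ring
  rw [obsG', hA, hA', hB, hB']
  unfold ginibreWeight
  rw [mul_neg, Finset.mul_sum, mul_neg, Finset.mul_sum, ← sub_eq_add_neg]
  congr 1
  · ring
  · exact Finset.sum_congr rfl fun a _ => by ring

/-- Along the family: if `χ₀(u s) = e^{ik₀s}` and `χₐ(u s) = e^{ikₐ s}` then the rotated integrand
`Im χ₀(u(s)θ) · w(u(s)θ)` is `G(s, θ)`. [folklore] -/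
private theorem rotated_eq_obsG {u : ℝ → Ω} (hu₀ : ∀ s, χ₀ (u s) = Circle.exp (k₀ * s))
    (hu : ∀ a s, χ a (u s) = Circle.exp (k a * s)) (s : ℝ) (θ : Ω) :
    imChar χ₀ (u s * θ) * ginibreWeight χ J (u s * θ) = obsG χ J χ₀ k₀ k s θ := by
  unfold obsG obsA hamB ginibreWeight ginibreHamiltonian
  rw [imChar_mul_of_eq_exp χ₀ (hu₀ s)]
  congr 1
  congr 1
  refine Finset.sum_congr rfl fun a _ => ?_
  rw [reChar_mul_of_eq_exp (χ a) (hu a s)]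

end LocalWard

end Integrand

section Ward

variable {Ω : Type*} [CommGroup Ω] [TopologicalSpace Ω] [IsTopologicalGroup Ω] [CompactSpace Ω]
  [SecondCountableTopology Ω] [MeasurableSpace Ω] [BorelSpace Ω] {ι : Type*} [Fintype ι]

open LocalWard in
/-- **The local Ward identity for a Ginibre model** (Aizenman–Simon (2.4) `⟨Ȧ⟩ = β⟨AḢ⟩`, the `N = 2` rotation of
one spin written for characters). Let `μ` be a Haar probability measure on the compact abelian group `Ω`,
`w = exp(∑ₐ Jₐ Re χₐ)`, and let `u : ℝ → Ω` be a family along which the characters are exponentials,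
`χ₀(u s) = e^{ik₀ s}`, `χₐ(u s) = e^{ikₐ s}`. Then
`k₀ ∫ Re χ₀ · w dμ = ∑ₐ Jₐ kₐ ∫ Im χ₀ · Im χₐ · w dμ`.
Proof: `s ↦ ∫ Im χ₀(u(s)θ) w(u(s)θ) dμ(θ)` is constant (left invariance of `μ`) and differentiable under the
integral sign (dominated derivative on a compact group); its derivative at `0` is the displayed difference.
[cite: AizenmanSimon1980LocalWard, eq. (2.4) and proof of Thm 3.1 (N = 2)] -/
theorem ginibre_localWard (μ : Measure Ω) [μ.IsHaarMeasure] [IsProbabilityMeasure μ] (χ : ι → Ω →ₜ* Circle)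
    (J : ι → ℝ) (χ₀ : Ω →ₜ* Circle) {u : ℝ → Ω} {k₀ : ℝ} {k : ι → ℝ} (hu₀ : ∀ s, χ₀ (u s) = Circle.exp (k₀ * s))
    (hu : ∀ a s, χ a (u s) = Circle.exp (k a * s)) :
    k₀ * ∫ θ, reChar χ₀ θ * ginibreWeight χ J θ ∂μ =
      ∑ a, J a * k a * ∫ θ, imChar χ₀ θ * imChar (χ a) θ * ginibreWeight χ J θ ∂μ := by
  -- the rotated integral is constant in `s`
  have hconst : ∀ s, ∫ θ, obsG χ J χ₀ k₀ k s θ ∂μ = ∫ θ, imChar χ₀ θ * ginibreWeight χ J θ ∂μ := by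
    intro s
    have h := integral_mul_left_eq_self (μ := μ) (fun θ => imChar χ₀ θ * ginibreWeight χ J θ) (u s)
    simp only [rotated_eq_obsG hu₀ hu] at h
    exact h
  -- differentiate under the integral sign at `s = 0`
  set M : ℝ := (2 * |k₀| + 4 * ∑ a, |J a * k a|) * Real.exp (2 * ∑ a, |J a|) with hM
  have hderiv := hasDerivAt_integral_of_dominated_loc_of_deriv_le (μ := μ) (x₀ := (0 : ℝ)) (s := Set.univ)
    (F := fun s θ => obsG χ J χ₀ k₀ k s θ) (F' := fun s θ => obsG' χ J χ₀ k₀ k s θ) (bound := fun _ => M)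
    Filter.univ_mem
    (Filter.Eventually.of_forall fun s => (continuous_obsG s).aestronglyMeasurable)
    (integrable_of_continuous_of_isFiniteMeasure μ (continuous_obsG 0))
    (continuous_obsG' 0).aestronglyMeasurable
    (ae_of_all _ fun θ s _ => by rw [Real.norm_eq_abs]; exact abs_obsG'_le s θ)
    (integrable_const M)
    (ae_of_all _ fun θ s _ => hasDerivAt_obsG s θ)
  have h1 : HasDerivAt (fun s => ∫ θ, obsG χ J χ₀ k₀ k s θ ∂μ) (∫ θ, obsG' χ J χ₀ k₀ k 0 θ ∂μ) 0 := hderiv.2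
  have h2 : HasDerivAt (fun s => ∫ θ, obsG χ J χ₀ k₀ k s θ ∂μ) 0 0 := by
    have : (fun s => ∫ θ, obsG χ J χ₀ k₀ k s θ ∂μ) = fun _ => ∫ θ, imChar χ₀ θ * ginibreWeight χ J θ ∂μ :=
      funext hconst
    rw [this]
    exact hasDerivAt_const _ _
  have hzero : ∫ θ, obsG' χ J χ₀ k₀ k 0 θ ∂μ = 0 := h1.unique h2
  -- expand the derivative at zero
  simp only [obsG'_zero] at hzero
  have hi1 : Integrable (fun θ => k₀ * (reChar χ₀ θ * ginibreWeight χ J θ)) μ :=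
    integrable_of_continuous_of_isFiniteMeasure μ
      (continuous_const.mul ((continuous_reChar χ₀).mul (continuous_ginibreWeight χ J)))
  have hi2 : ∀ a ∈ (Finset.univ : Finset ι),
      Integrable (fun θ => J a * k a * (imChar χ₀ θ * imChar (χ a) θ * ginibreWeight χ J θ)) μ :=
    fun a _ => integrable_of_continuous_of_isFiniteMeasure μ
      (continuous_const.mul (((continuous_imChar χ₀).mul (continuous_imChar (χ a))).mul
        (continuous_ginibreWeight χ J)))
  rw [integral_sub hi1 (integrable_finsetSum _ hi2), integral_finsetSum _ hi2, integral_const_mul] at hzero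
  simp only [integral_const_mul] at hzero
  linarith

/-- **The local Ward inequality.** Under the hypotheses of `ginibre_localWard` and `J ≥ 0`:
`k₀ ⟨Re χ₀⟩_J ≤ ½ ∑ₐ Jₐ (kₐ⁺ ⟨Re(χ₀χₐ⁻¹)⟩_J + kₐ⁻ ⟨Re(χ₀χₐ)⟩_J)` — the Ward identity, the product formula
`2 Im χ₀ Im χₐ = Re(χ₀χₐ⁻¹) − Re(χ₀χₐ)` and Griffiths' first inequality `⟨Re χ⟩_J ≥ 0` (tree
`ginibreExpect_reChar_nonneg`) to drop the terms of the wrong sign (Aizenman–Simon prove the `N`-component version,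
Thm 3.1, with Simon's inequality in place of Griffiths' first). [cite: AizenmanSimon1980LocalWard, Thm 3.1 (N = 2)] -/
theorem ginibreExpect_reChar_le_localWard (μ : Measure Ω) [μ.IsHaarMeasure] [IsProbabilityMeasure μ]
    (h2 : Function.Surjective fun ψ : Ω => ψ * ψ) (χ : ι → Ω →ₜ* Circle) {J : ι → ℝ} (hJ : ∀ a, 0 ≤ J a)
    (χ₀ : Ω →ₜ* Circle) {u : ℝ → Ω} {k₀ : ℝ} {k : ι → ℝ} (hu₀ : ∀ s, χ₀ (u s) = Circle.exp (k₀ * s))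
    (hu : ∀ a s, χ a (u s) = Circle.exp (k a * s)) :
    k₀ * ginibreExpect μ χ J (reChar χ₀) ≤
      (1 / 2) * ∑ a, J a * (max (k a) 0 * ginibreExpect μ χ J (reChar (χ₀ * (χ a)⁻¹)) +
        max (-(k a)) 0 * ginibreExpect μ χ J (reChar (χ₀ * χ a))) := by
  have hZ : 0 < ∫ θ, ginibreWeight χ J θ ∂μ :=
    integral_exp_pos (integrable_of_continuous_compactSpace μ (continuous_ginibreWeight χ J))
  have hW := ginibre_localWard μ χ J χ₀ hu₀ hu
  -- rewrite each `∫ Im χ₀ Im χₐ w` through the product formula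
  have hprod : ∀ a, ∫ θ, imChar χ₀ θ * imChar (χ a) θ * ginibreWeight χ J θ ∂μ =
      (1 / 2) * (∫ θ, reChar (χ₀ * (χ a)⁻¹) θ * ginibreWeight χ J θ ∂μ -
        ∫ θ, reChar (χ₀ * χ a) θ * ginibreWeight χ J θ ∂μ) := by
    intro a
    have hi1 : Integrable (fun θ => reChar (χ₀ * (χ a)⁻¹) θ * ginibreWeight χ J θ) μ :=
      integrable_of_continuous_of_isFiniteMeasure μ ((continuous_reChar _).mul (continuous_ginibreWeight χ J))
    have hi2 : Integrable (fun θ => reChar (χ₀ * χ a) θ * ginibreWeight χ J θ) μ :=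
      integrable_of_continuous_of_isFiniteMeasure μ ((continuous_reChar _).mul (continuous_ginibreWeight χ J))
    rw [← integral_sub hi1 hi2, ← integral_const_mul]
    refine integral_congr_ae (ae_of_all _ fun θ => ?_)
    have := two_mul_imChar_mul_imChar χ₀ (χ a) θ
    simp only
    rw [← sub_mul, ← this]
    ring
  -- Griffiths' first inequality for the two products
  have hG1 : ∀ a, 0 ≤ ∫ θ, reChar (χ₀ * (χ a)⁻¹) θ * ginibreWeight χ J θ ∂μ := fun a => by
    have h := Literature.MathematicalPhysics.QuantumFieldTheory.ginibreExpect_reChar_nonneg μ h2 χ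
      (χ₀ * (χ a)⁻¹) hJ
    unfold ginibreExpect at h
    exact (div_nonneg_iff.1 h).elim (fun h' => h'.1) fun h' => absurd h'.2 (not_le.2 hZ)
  have hG2 : ∀ a, 0 ≤ ∫ θ, reChar (χ₀ * χ a) θ * ginibreWeight χ J θ ∂μ := fun a => by
    have h := Literature.MathematicalPhysics.QuantumFieldTheory.ginibreExpect_reChar_nonneg μ h2 χ (χ₀ * χ a) hJ
    unfold ginibreExpect at h
    exact (div_nonneg_iff.1 h).elim (fun h' => h'.1) fun h' => absurd h'.2 (not_le.2 hZ)
  -- termwise estimate `J k (X − Y)/2 ≤ J (k⁺ X + k⁻ Y)/2`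
  have hterm : ∀ a, J a * k a * ∫ θ, imChar χ₀ θ * imChar (χ a) θ * ginibreWeight χ J θ ∂μ ≤
      (1 / 2) * (J a * (max (k a) 0 * ∫ θ, reChar (χ₀ * (χ a)⁻¹) θ * ginibreWeight χ J θ ∂μ +
        max (-(k a)) 0 * ∫ θ, reChar (χ₀ * χ a) θ * ginibreWeight χ J θ ∂μ)) := by
    intro a
    rw [hprod a]
    have hX := hG1 a
    have hY := hG2 a
    have hJa := hJ a
    set X := ∫ θ, reChar (χ₀ * (χ a)⁻¹) θ * ginibreWeight χ J θ ∂μ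
    set Y := ∫ θ, reChar (χ₀ * χ a) θ * ginibreWeight χ J θ ∂μ
    set kp := max (k a) 0 with hkp_def
    set km := max (-(k a)) 0 with hkm_def
    have hkp : 0 ≤ kp := le_max_right _ _
    have hkm : 0 ≤ km := le_max_right _ _
    have hk : k a = kp - km := (max_zero_sub_max_neg_zero_eq_self (k a)).symm
    have key : J a * k a * (1 / 2 * (X - Y)) + 1 / 2 * (J a * (kp * Y + km * X)) =
        1 / 2 * (J a * (kp * X + km * Y)) := by
      rw [hk]; ring
    have hnn : 0 ≤ 1 / 2 * (J a * (kp * Y + km * X)) := by positivity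
    linarith
  -- assemble and divide by the partition function
  unfold ginibreExpect
  have hsum := Finset.sum_le_sum fun a (_ : a ∈ (Finset.univ : Finset ι)) => hterm a
  rw [← hW, ← Finset.mul_sum] at hsum
  rw [mul_div_assoc', div_le_iff₀ hZ]
  calc k₀ * ∫ θ, reChar χ₀ θ * ginibreWeight χ J θ ∂μ
      ≤ 1 / 2 * ∑ a, J a * (max (k a) 0 * ∫ θ, reChar (χ₀ * (χ a)⁻¹) θ * ginibreWeight χ J θ ∂μ +
          max (-(k a)) 0 * ∫ θ, reChar (χ₀ * χ a) θ * ginibreWeight χ J θ ∂μ) := hsum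
    _ = 1 / 2 * (∑ a, J a * (max (k a) 0 * ((∫ θ, reChar (χ₀ * (χ a)⁻¹) θ * ginibreWeight χ J θ ∂μ) /
            ∫ θ, ginibreWeight χ J θ ∂μ) +
          max (-(k a)) 0 * ((∫ θ, reChar (χ₀ * χ a) θ * ginibreWeight χ J θ ∂μ) /
            ∫ θ, ginibreWeight χ J θ ∂μ))) * ∫ θ, ginibreWeight χ J θ ∂μ := by
        rw [mul_assoc, Finset.sum_mul]
        congr 1
        refine Finset.sum_congr rfl fun a _ => ?_
        field_simp

end Ward

/-! ### A discrete decay lemma: subharmonic functions with a defect decay geometrically -/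

section Decay

variable {V : Type*} [Fintype V]

/-- **Decay from the local Ward inequality** (Aizenman–Simon's Thm 3.2 argument in a finite-volume, limit-free
form). Let `G ≤ 1` on a finite set, `K ≥ 0` with row sums `∑_y K x y ≤ 𝒥`, and `G x ≤ ½ ∑_y K x y G y` for all
`x ≠ c`. If `d : V → ℕ` vanishes at `c` and is `1`-Lipschitz along the support of `K` (`K x y ≠ 0 ⇒ d x ≤ d y + 1`;
Remark 4 of the source: only the triangle inequality is used), then `G x ≤ (𝒥/2)^{d x}` for every `x`.
Proof: for `𝒥/2 ≤ 1`, by induction on `n`, `G ≤ max((𝒥/2)^{d}, (𝒥/2)^n)`; for `𝒥/2 > 1` the bound exceeds `1`.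
[cite: AizenmanSimon1980LocalWard, Thm 3.2 and Remark 4] -/
theorem decay_of_subharmonic {G : V → ℝ} {K : V → V → ℝ} {c : V} {𝒥 : ℝ} (hG1 : ∀ x, G x ≤ 1) (hK : ∀ x y, 0 ≤ K x y) (hrow : ∀ x, ∑ y, K x y ≤ 𝒥)
    (hsub : ∀ x, x ≠ c → G x ≤ (1 / 2) * ∑ y, K x y * G y) {d : V → ℕ} (hd0 : d c = 0)
    (hd : ∀ x y, K x y ≠ 0 → d x ≤ d y + 1) (x : V) : G x ≤ (𝒥 / 2) ^ d x := by
  set s : ℝ := 𝒥 / 2 with hs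
  have h𝒥 : 0 ≤ 𝒥 := (Finset.sum_nonneg fun y _ => hK x y).trans (hrow x)
  have hs0 : 0 ≤ s := by rw [hs]; positivity
  by_cases hs1 : s ≤ 1
  swap
  · exact (hG1 x).trans (one_le_pow₀ (not_le.1 hs1).le)
  -- `P n : ∀ x, G x ≤ max (s ^ d x) (s ^ n)` by induction on `n`
  have hP : ∀ n : ℕ, ∀ z, G z ≤ max (s ^ d z) (s ^ n) := by
    intro n
    induction n with
    | zero => exact fun z => (hG1 z).trans (by rw [pow_zero]; exact le_max_right _ _)
    | succ n ih =>
      intro z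
      by_cases hzc : z = c
      · subst hzc
        rw [hd0, pow_zero]
        exact (hG1 _).trans (le_max_left _ _)
      by_cases hdz : d z = 0
      · rw [hdz, pow_zero]
        exact (hG1 _).trans (le_max_left _ _)
      have hdz1 : 1 ≤ d z := Nat.one_le_iff_ne_zero.2 hdz
      set m : ℝ := max (s ^ (d z - 1)) (s ^ n) with hm
      have hm0 : 0 ≤ m := le_max_of_le_right (pow_nonneg hs0 n)
      -- termwise: `K z y · G y ≤ K z y · m`
      have hterm : ∀ y, K z y * G y ≤ K z y * m := by
        intro y
        by_cases hKy : K z y = 0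
        · rw [hKy, zero_mul, zero_mul]
        refine mul_le_mul_of_nonneg_left ((ih y).trans (max_le_max ?_ le_rfl)) (hK z y)
        have hdy : d z - 1 ≤ d y := by have := hd z y hKy; omega
        exact pow_le_pow_of_le_one hs0 hs1 hdy
      have hsum : ∑ y, K z y * G y ≤ 𝒥 * m :=
        calc ∑ y, K z y * G y ≤ ∑ y, K z y * m := Finset.sum_le_sum fun y _ => hterm y
          _ = (∑ y, K z y) * m := by rw [Finset.sum_mul]
          _ ≤ 𝒥 * m := mul_le_mul_of_nonneg_right (hrow z) hm0
      calc G z ≤ (1 / 2) * ∑ y, K z y * G y := hsub z hzc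
        _ ≤ (1 / 2) * (𝒥 * m) := by gcongr
        _ = s * m := by rw [hs]; ring
        _ = max (s * s ^ (d z - 1)) (s * s ^ n) := by rw [hm, mul_max_of_nonneg _ _ hs0]
        _ = max (s ^ d z) (s ^ (n + 1)) := by
            rw [← pow_succ', ← pow_succ', Nat.sub_add_cancel hdz1]
  have h := hP (d x) x
  rwa [max_self] at h

end Decay

namespace PlaneRotator

/-! ### Plane rotators: the local Ward inequality of Aizenman–Simon (`N = 2`) -/

section MeanField

variable {V : Type*}

section Algebra

variable [DecidableEq V]

/-- The rotation of the single spin `a` by the angle `s`: `θ ↦ (e^{is} at a, 1 elsewhere)·θ`. [folklore] -/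
def rot (a : V) (s : ℝ) : V → Circle :=
  Pi.mulSingle a (Circle.exp s)

/-- The charge of the bond character `θ̄_x θ_y` under the rotation of spin `a`: `[y = a] − [x = a]`. [folklore] -/
def rotWeight (a : V) (p : V × V) : ℝ :=
  (if p.2 = a then 1 else 0) - (if p.1 = a then 1 else 0)

/-- `θ̄_x θ_y` evaluated on the rotation of spin `a` by `s` is `e^{i([y=a]−[x=a])s}`. [folklore] -/
private theorem diffChar_rot (a x y : V) (s : ℝ) : diffChar x y (rot a s) = Circle.exp (rotWeight a (x, y) * s) := by
  unfold rot rotWeight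
  rw [diffChar_apply]
  by_cases hx : x = a <;> by_cases hy : y = a <;> simp [hx, hy]

end Algebra

/-- Character algebra: `(θ̄_c θ_a)(θ̄_x θ_a)⁻¹ = θ̄_c θ_x`. [folklore] -/
private theorem diffChar_mul_inv_diffChar (c a x : V) : diffChar c a * (diffChar x a)⁻¹ = diffChar c x := by
  ext θ
  rw [ContinuousMonoidHom.mul_apply, inv_charApply, diffChar_apply, diffChar_apply, diffChar_apply]
  congr 1
  group

/-- Character algebra: `(θ̄_c θ_a)(θ̄_a θ_y) = θ̄_c θ_y`. [folklore] -/
private theorem diffChar_mul_diffChar (c a y : V) : diffChar c a * diffChar a y = diffChar c y := by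
  ext θ
  rw [ContinuousMonoidHom.mul_apply, diffChar_apply, diffChar_apply, diffChar_apply]
  congr 1
  group

variable [Fintype V] [MeasurableSpace Circle] [BorelSpace Circle]

/-- The two-point function of Ginibre's plane-rotator example is symmetric, `⟨cos(θ_a − θ_b)⟩ = ⟨cos(θ_b − θ_a)⟩`.
[cite: Ginibre1970, Example 4 (plane rotators)] -/
theorem twoPoint_comm (J : V × V → ℝ) (a b : V) : twoPoint J a b = twoPoint J b a := by
  unfold twoPoint
  congr 1
  funext θ
  unfold cosDiff
  rw [← Complex.conj_re (starRingEnd ℂ ((θ a : Circle) : ℂ) * θ b), map_mul, Complex.conj_conj, mul_comm]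

/-- **Griffiths' first inequality** for XY two-point functions with general pair couplings `J ≥ 0`:
`0 ≤ ⟨cos(θ_a − θ_b)⟩_{V,J}` (tree `ginibreExpect_reChar_nonneg`). [cite: Ginibre1970, Prop. 3 with Example 4 (plane rotators)] -/
theorem twoPoint_nonneg {J : V × V → ℝ} (hJ : ∀ p, 0 ≤ J p) (a b : V) : 0 ≤ twoPoint J a b := by
  rw [twoPoint_eq_ginibreExpect_reChar]
  exact Literature.MathematicalPhysics.QuantumFieldTheory.ginibreExpect_reChar_nonneg _ surjective_mul_self_torus
    _ _ hJ

/-- `⟨cos(θ_a − θ_b)⟩ ≤ 1` for the plane-rotator Gibbs state (the observable is bounded by `1`, the weight is positive).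
[cite: Ginibre1970, Example 4 (plane rotators)] -/
theorem twoPoint_le_one (J : V × V → ℝ) (a b : V) : twoPoint J a b ≤ 1 := by
  unfold twoPoint ginibreExpect
  have hwc := continuous_ginibreWeight (pairChars V) J
  have hZ : 0 < ∫ θ, ginibreWeight (pairChars V) J θ ∂torusHaar V :=
    integral_exp_pos (integrable_of_continuous_compactSpace _ hwc)
  rw [div_le_one hZ]
  refine integral_mono (integrable_torusHaar_of_continuous ((continuous_cosDiff a b).mul hwc))
    (integrable_torusHaar_of_continuous hwc) fun θ => ?_
  have h1 : cosDiff a b θ ≤ 1 := (le_abs_self _).trans (abs_cosDiff_le_one a b θ)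
  have hw : 0 < ginibreWeight (pairChars V) J θ := Real.exp_pos _
  nlinarith

/-- **Aizenman–Simon's local Ward inequality for plane rotators (their Theorem 3.1, `N = 2`).** For non-negative
pair couplings `J` on ordered pairs and `a ≠ c`:
`⟨cos(θ_a − θ_c)⟩_{V,J} ≤ ½ ∑_y (J(a,y) + J(y,a)) ⟨cos(θ_y − θ_c)⟩_{V,J}`.
(Rotate the single spin `a`: the Ward identity gives `⟨cos(θ_a−θ_c)⟩ = ∑_y J̃_{ay}⟨sin(θ_a−θ_c) sin(θ_a−θ_y)⟩`,
`J̃_{ay} = J(a,y)+J(y,a)`, and `2 sin(θ_a−θ_c) sin(θ_a−θ_y) = cos(θ_y−θ_c) − cos(2θ_a−θ_c−θ_y)` with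
`⟨cos(2θ_a−θ_c−θ_y)⟩ ≥ 0` by Griffiths' first inequality; the diagonal `y = a` term on the right is a harmless
non-negative addition.) In the physical normalisation `−βH = β∑_{bonds} J_{xy} cos(θ_x−θ_y)` (each bond once,
`J(x,y) = J(y,x) = βJ_{xy}/2` here) this reads `⟨σ_a·σ_c⟩ ≤ (β/2)∑_y J_{ay}⟨σ_y·σ_c⟩`. [cite: AizenmanSimon1980LocalWard, Thm 3.1 (N = 2)] -/
theorem twoPoint_le_half_sum_mul_twoPoint {J : V × V → ℝ} (hJ : ∀ p, 0 ≤ J p) {a c : V} (hac : a ≠ c) :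
    twoPoint J a c ≤ (1 / 2) * ∑ y, (J (a, y) + J (y, a)) * twoPoint J y c := by
  classical
  -- the abstract inequality for the rotation of spin `a`
  have hk₀ : rotWeight a (c, a) = 1 := by simp [rotWeight, hac.symm]
  have hu₀ : ∀ s, diffChar c a (rot a s) = Circle.exp (1 * s) := fun s => by rw [← hk₀]; exact diffChar_rot a c a s
  have hu : ∀ (p : V × V) s, pairChars V p (rot a s) = Circle.exp (rotWeight a p * s) :=
    fun p s => diffChar_rot a p.1 p.2 s
  have hW := ginibreExpect_reChar_le_localWard (torusHaar V) surjective_mul_self_torus (pairChars V) hJ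
    (diffChar c a) hu₀ hu
  rw [one_mul, ← twoPoint_eq_ginibreExpect_reChar, twoPoint_comm] at hW
  refine hW.trans ?_
  -- name the two-point functions towards `c`
  set G : V → ℝ := fun y => twoPoint J y c with hG
  -- termwise comparison with `J(x,y)·([y = a] G x + [x = a] G y)`
  have hterm : ∀ x y : V,
      J (x, y) * (max (rotWeight a (x, y)) 0 *
          ginibreExpect (torusHaar V) (pairChars V) J (reChar (diffChar c a * (pairChars V (x, y))⁻¹)) +
        max (-(rotWeight a (x, y))) 0 *
          ginibreExpect (torusHaar V) (pairChars V) J (reChar (diffChar c a * pairChars V (x, y)))) ≤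
      J (x, y) * ((if y = a then G x else 0) + (if x = a then G y else 0)) := by
    intro x y
    have hGx : 0 ≤ G x := twoPoint_nonneg hJ x c
    have hGy : 0 ≤ G y := twoPoint_nonneg hJ y c
    by_cases hx : x = a <;> by_cases hy : y = a
    · subst hx; subst hy
      simp only [rotWeight, if_true, sub_self, max_self, neg_zero, zero_mul, add_zero, mul_zero]
      exact mul_nonneg (hJ _) (add_nonneg hGx hGx)
    · subst hx
      have e : ginibreExpect (torusHaar V) (pairChars V) J (reChar (diffChar c x * pairChars V (x, y))) = G y := by
        rw [pairChars_apply, diffChar_mul_diffChar, ← twoPoint_eq_ginibreExpect_reChar, twoPoint_comm]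
      simp only [rotWeight, hy, if_false, if_true, zero_sub, max_eq_right (neg_nonpos.2 zero_le_one), neg_neg,
        max_eq_left zero_le_one, zero_mul, one_mul, zero_add, e]
      exact le_rfl
    · subst hy
      have e : ginibreExpect (torusHaar V) (pairChars V) J (reChar (diffChar c y * (pairChars V (x, y))⁻¹)) = G x := by
        rw [pairChars_apply, diffChar_mul_inv_diffChar, ← twoPoint_eq_ginibreExpect_reChar, twoPoint_comm]
      simp only [rotWeight, hx, if_false, if_true, sub_zero, max_eq_left zero_le_one,
        max_eq_right (neg_nonpos.2 zero_le_one), zero_mul, one_mul, add_zero, e]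
      exact le_rfl
    · simp only [rotWeight, hx, hy, if_false, sub_self, max_self, neg_zero, zero_mul, add_zero, mul_zero]
      exact le_rfl
  have hsum : ∑ p, J p * (max (rotWeight a p) 0 *
          ginibreExpect (torusHaar V) (pairChars V) J (reChar (diffChar c a * (pairChars V p)⁻¹)) +
        max (-(rotWeight a p)) 0 * ginibreExpect (torusHaar V) (pairChars V) J (reChar (diffChar c a * pairChars V p)))
      ≤ ∑ x, ∑ y, J (x, y) * ((if y = a then G x else 0) + (if x = a then G y else 0)) := by
    rw [Fintype.sum_prod_type]
    exact Finset.sum_le_sum fun x _ => Finset.sum_le_sum fun y _ => hterm x y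
  -- evaluate the right-hand side
  have heval : ∑ x, ∑ y, J (x, y) * ((if y = a then G x else 0) + (if x = a then G y else 0)) =
      ∑ y, (J (a, y) + J (y, a)) * G y := by
    have h1 : ∑ x, ∑ y, J (x, y) * (if y = a then G x else 0) = ∑ x, J (x, a) * G x := by
      refine Finset.sum_congr rfl fun x _ => ?_
      simp [mul_ite]
    have h2 : ∑ x, ∑ y, J (x, y) * (if x = a then G y else 0) = ∑ y, J (a, y) * G y := by
      rw [Finset.sum_comm]
      refine Finset.sum_congr rfl fun y _ => ?_
      simp [mul_ite]
    simp only [mul_add, Finset.sum_add_distrib, h1, h2, add_mul]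
    rw [add_comm]
  rw [heval] at hsum
  exact mul_le_mul_of_nonneg_left hsum (by norm_num)

/-- **Mass gap above the mean-field temperature (Aizenman–Simon Thm 3.2, `N = 2`), finite-volume form.** Let
`J ≥ 0` have symmetrised row sums `∑_y (J(x,y) + J(y,x)) ≤ 𝒥` for every `x`, and let `d : V → ℕ` vanish at `c` and
be `1`-Lipschitz along the bonds (`J(x,y) + J(y,x) ≠ 0 ⇒ d x ≤ d y + 1`). Then for every `a`,
`⟨cos(θ_a − θ_c)⟩_{V,J} ≤ (𝒥/2)^{d a}` — the same bound in every volume. For `𝒥 < 2` (in the physical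
normalisation: `β sup_x ∑_y J_{xy} < 2 = N`, i.e. above the `N = 2` mean-field transition temperature) this is
exponential decay of the two-point function with the graph distance from `c`, with volume-independent rate
`log(2/𝒥)`. [cite: AizenmanSimon1980LocalWard, Thm 3.2 (mass gap for β sup_i N⁻¹Σ_k J_ik < 1) and Remark 4] -/
theorem twoPoint_le_pow_of_rowSum_le {J : V × V → ℝ} (hJ : ∀ p, 0 ≤ J p) {𝒥 : ℝ}
    (hrow : ∀ x, ∑ y, (J (x, y) + J (y, x)) ≤ 𝒥) (c : V) {d : V → ℕ} (hd0 : d c = 0)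
    (hd : ∀ x y, J (x, y) + J (y, x) ≠ 0 → d x ≤ d y + 1) (a : V) :
    twoPoint J a c ≤ (𝒥 / 2) ^ d a := by
  classical
  exact decay_of_subharmonic (G := fun y => twoPoint J y c) (K := fun x y => J (x, y) + J (y, x))
    (fun x => twoPoint_le_one J x c) (fun _ _ => add_nonneg (hJ _) (hJ _)) hrow
    (fun _ hx => twoPoint_le_half_sum_mul_twoPoint hJ hx) hd0 hd a

end MeanField

/-! ### The layered XY model on `ℤ³`: `⟨cos(θ_a − θ_c)⟩_Λ ≤ (β(2J∥ + J⊥))^{|a − c|₁}` -/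

section Layered

open Literature.Barriers.CriticalPhenomena Literature.Barriers.CriticalPhenomena.LongRangeIsing

/-- Triangle inequality for the `ℓ¹` norm on `ℤ^d`. [folklore] -/
private theorem l1Norm_add_le {d : ℕ} (x y : Site d) : l1Norm (x + y) ≤ l1Norm x + l1Norm y := by
  unfold l1Norm
  rw [← Finset.sum_add_distrib]
  exact Finset.sum_le_sum fun i _ => Int.natAbs_add_le _ _

/-- The plane-rotator couplings of the **layered XY model** at inverse temperature `β` on a finite `Λ ⊂ ℤ³`
(free boundary conditions), in the ordered-pair convention of `PlaneRotator.twoPoint`: `J(x,y) = (β/2)·J_{x,y}` with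
`J_{x,y}` the tree's `layeredCoupling J∥ J⊥` (`J∥` on in-plane nearest-neighbour bonds, `J⊥` on the stacking
bonds), so that the Gibbs weight is `exp(β ∑_{bonds {x,y} ⊂ Λ} J_{x,y} cos(θ_x − θ_y))`.
[cite: LiuStanley1972, p. 272 (layers (J, J, εJ))] -/
def layeredXYCoupling (β Jp Jz : ℝ) (Λ : Finset (Site 3)) (p : Λ × Λ) : ℝ :=
  β / 2 * layeredCoupling Jp Jz (p.1 : Site 3) (p.2 : Site 3)

variable {β Jp Jz : ℝ}

/-- The layered XY couplings are non-negative (ferromagnetic) for `β, J∥, J⊥ ≥ 0` — assumption (A1) of the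
pair-interaction framework. [cite: Panis2023Triviality, §1.2.1 (assumptions (A1)–(A5) on J)] -/
theorem layeredXYCoupling_nonneg (hβ : 0 ≤ β) (hp : 0 ≤ Jp) (hz : 0 ≤ Jz) (Λ : Finset (Site 3)) (p : Λ × Λ) :
    0 ≤ layeredXYCoupling β Jp Jz Λ p :=
  mul_nonneg (by positivity) (layeredCoupling_nonneg hp hz _ _)

/-- Symmetrised row sums of the layered XY couplings are at most `β(4J∥ + 2J⊥)` (four in-plane and two axial
neighbours; tree `sum_layeredCoupling_le`): the interaction norm `|J| = sup_x ∑_y J_{x,y}` of assumption (A2).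
[cite: Panis2023Triviality, §1.2.1 (assumption (A2): |J| = sup_x Σ_y J_{x,y})] -/
theorem sum_layeredXYCoupling_le (hβ : 0 ≤ β) (hp : 0 ≤ Jp) (hz : 0 ≤ Jz) (Λ : Finset (Site 3)) (x : Λ) :
    ∑ y : Λ, (layeredXYCoupling β Jp Jz Λ (x, y) + layeredXYCoupling β Jp Jz Λ (y, x)) ≤ β * (4 * Jp + 2 * Jz) := by
  have hsym : ∀ y : Λ, layeredXYCoupling β Jp Jz Λ (x, y) + layeredXYCoupling β Jp Jz Λ (y, x) =
      β * layeredCoupling Jp Jz (x : Site 3) (y : Site 3) := fun y => by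
    unfold layeredXYCoupling
    rw [layeredCoupling_symm (y : Site 3) (x : Site 3)]
    ring
  simp_rw [hsym]
  rw [← Finset.mul_sum]
  refine mul_le_mul_of_nonneg_left ?_ hβ
  have h := sum_layeredCoupling_le hp hz Λ (x : Site 3)
  rwa [← Finset.sum_coe_sort Λ] at h

variable [MeasurableSpace Circle] [BorelSpace Circle]

/-- **Mean-field bound for the layered XY model** (the `pub/hubbard-tc` K5-MF ceiling, XY side, as a kernel
theorem). For `β, J∥, J⊥ ≥ 0`, every finite `Λ ⊂ ℤ³` and all `a, c ∈ Λ`: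
`⟨cos(θ_a − θ_c)⟩_{Λ,β} ≤ (β(2J∥ + J⊥))^{|a − c|₁}`.
Hence for `k_B T > 2J∥ + J⊥` the two-point function of the classical layered XY model decays exponentially in the
`ℓ¹` distance at rate `log(T/(2J∥+J⊥))`, uniformly in the volume — `k_B T_c^{XY}(J∥, J⊥) ≤ 2J∥ + J⊥` in the
finite-volume sense (Aizenman–Simon's mass gap above the `N = 2` mean-field temperature
`β_{MF}⁻¹ = ½ sup_x ∑_y J_{xy} = 2J∥ + J⊥`); `J⊥ = 0` gives the planar bound `2J∥` (`β_c ≥ 1/2` at `J∥ = 1`,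
the value quoted in [AizenmanSimon1980RotorIsing]). The cell reads it with `J∥ = ρ̄_s/2` (certified pair-phase
stiffness ceiling) and `J⊥ = J̄⊥` under its modelling key K5 — a statement about the classical effective model,
never a certified material `T_c`. [cite: AizenmanSimon1980LocalWard, Thm 3.2 (mass gap above the mean-field temperature, N = 2)] -/
theorem twoPoint_layered_le_pow (hβ : 0 ≤ β) (hp : 0 ≤ Jp) (hz : 0 ≤ Jz) (Λ : Finset (Site 3)) (a c : Λ) :
    twoPoint (layeredXYCoupling β Jp Jz Λ) a c ≤ (β * (2 * Jp + Jz)) ^ l1Norm ((a : Site 3) - (c : Site 3)) := by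
  have h := twoPoint_le_pow_of_rowSum_le (layeredXYCoupling_nonneg hβ hp hz Λ) (sum_layeredXYCoupling_le hβ hp hz Λ)
    c (d := fun y : Λ => l1Norm ((y : Site 3) - (c : Site 3))) (by simp [l1Norm]) ?_ a
  · have e : β * (4 * Jp + 2 * Jz) / 2 = β * (2 * Jp + Jz) := by ring
    rwa [e] at h
  · -- the `ℓ¹` distance to `c` is `1`-Lipschitz along nearest-neighbour bonds
    intro x y hxy
    have hne : layeredCoupling Jp Jz (x : Site 3) (y : Site 3) ≠ 0 := by
      intro h0
      apply hxy
      unfold layeredXYCoupling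
      rw [layeredCoupling_symm (y : Site 3) (x : Site 3), h0]
      ring
    have h1 : l1Norm ((x : Site 3) - (y : Site 3)) = 1 := by
      unfold layeredCoupling at hne
      by_contra h
      exact hne (if_neg h)
    have htri := l1Norm_add_le ((x : Site 3) - (y : Site 3)) ((y : Site 3) - (c : Site 3))
    rw [sub_add_sub_cancel, h1] at htri
    simpa [add_comm] using htri

end Layered

/-! ### The isotropic nearest-neighbour XY model on `ℤ^d`: `⟨cos(θ_a − θ_c)⟩_Λ ≤ (dK)^{|a−c|₁}`, i.e. `k_B T_c ≤ d·J` -/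

section NearestNeighbour

open Literature.Barriers.CriticalPhenomena Literature.Barriers.CriticalPhenomena.LongRangeIsing

/-- At most `2d` sites of any finite `Λ ⊂ ℤ^d` are nearest neighbours of `x` (they are among `x ± eᵢ`). [folklore] -/
private theorem card_filter_nn_le {d : ℕ} (Λ : Finset (Site d)) (x : Site d) :
    #(Λ.filter fun y => l1Norm (x - y) = 1) ≤ 2 * d := by
  classical
  set S : Finset (Site d) :=
    (Finset.univ : Finset (Fin d × Bool)).image fun q => if q.2 then Pi.single q.1 1 else -Pi.single q.1 1
    with hS
  calc #(Λ.filter fun y => l1Norm (x - y) = 1)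
      ≤ #(S.image fun z => x - z) := by
        refine Finset.card_le_card fun y hy => ?_
        rw [Finset.mem_filter] at hy
        refine Finset.mem_image.2 ⟨x - y, ?_, sub_sub_cancel x y⟩
        obtain ⟨i, hi⟩ := eq_single_or_of_l1Norm_eq_one hy.2
        rw [hS, Finset.mem_image]
        rcases hi with h | h
        · exact ⟨(i, true), Finset.mem_univ _, by simp [h]⟩
        · exact ⟨(i, false), Finset.mem_univ _, by simp [h]⟩
    _ ≤ #S := Finset.card_image_le
    _ ≤ #(Finset.univ : Finset (Fin d × Bool)) := Finset.card_image_le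
    _ = 2 * d := by simp [Finset.card_univ, mul_comm]

/-- The plane-rotator couplings of the **isotropic nearest-neighbour XY model on a finite `Λ ⊂ ℤ^d`** at dimensionless
coupling `K = βJ` (ordered-pair convention: `K/2` on each ordered nearest-neighbour pair, i.e. weight
`exp(K ∑_{bonds} cos(θ_x − θ_y))`; tree `LongRangeIsing.nnCoupling`). [cite: Panis2023Triviality, §1.2.1 (examples: nearest-neighbour interactions)] -/
def nnXYCoupling (K : ℝ) (d : ℕ) (Λ : Finset (Site d)) (p : Λ × Λ) : ℝ :=
  K / 2 * nnCoupling d (p.1 : Site d) (p.2 : Site d)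

/-- Symmetrised row sums of the nearest-neighbour XY couplings are at most `2dK` (coordination number `2d`):
the interaction norm `|J| = sup_x ∑_y J_{x,y}` of assumption (A2).
[cite: Panis2023Triviality, §1.2.1 (assumption (A2): |J| = sup_x Σ_y J_{x,y})] -/
theorem sum_nnXYCoupling_le {K : ℝ} (hK : 0 ≤ K) {d : ℕ} (Λ : Finset (Site d)) (x : Λ) :
    ∑ y : Λ, (nnXYCoupling K d Λ (x, y) + nnXYCoupling K d Λ (y, x)) ≤ 2 * d * K := by
  have hsym : ∀ y : Λ, nnXYCoupling K d Λ (x, y) + nnXYCoupling K d Λ (y, x) =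
      K * nnCoupling d (x : Site d) (y : Site d) := fun y => by
    unfold nnXYCoupling nnCoupling
    rw [l1Norm_sub_comm (y : Site d) (x : Site d)]
    ring
  simp_rw [hsym]
  rw [← Finset.mul_sum]
  have hrow : ∑ y : Λ, nnCoupling d (x : Site d) (y : Site d) ≤ 2 * d := by
    have h : ∑ y ∈ Λ, nnCoupling d (x : Site d) y = (#(Λ.filter fun y => l1Norm ((x : Site d) - y) = 1) : ℝ) := by
      simp only [nnCoupling, Finset.sum_boole]
    rw [Finset.sum_coe_sort Λ (fun y => nnCoupling d (x : Site d) y), h]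
    exact_mod_cast card_filter_nn_le Λ (x : Site d)
  calc K * ∑ y : Λ, nnCoupling d (x : Site d) (y : Site d) ≤ K * (2 * d) := mul_le_mul_of_nonneg_left hrow hK
    _ = 2 * d * K := by ring

variable [MeasurableSpace Circle] [BorelSpace Circle]

/-- **Mean-field bound for the nearest-neighbour XY model on `ℤ^d`** (Aizenman–Simon's mass gap above the `N = 2`
mean-field temperature, `β_{MF} = N/(2dJ) = 1/(dJ)`; for `d = 2`, `J = 1` this is the bound `β_c ≥ 1/2` quoted in
[AizenmanSimon1980RotorIsing]). For `K = βJ ≥ 0`, every finite `Λ ⊂ ℤ^d` (free boundary conditions) and `a, c ∈ Λ`: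
`⟨cos(θ_a − θ_c)⟩_{Λ,K} ≤ (dK)^{|a − c|₁}` — exponential decay uniformly in `Λ` whenever `k_B T > d·J`, i.e.
`k_B T_c^{XY}(ℤ^d) ≤ d·J` in finite-volume form (`d = 2`: `T_BKT ≤ 2J`; `d = 3`: `T_c ≤ 3J`, MC `2.20J`).
[cite: AizenmanSimon1980LocalWard, Thm 3.2 (mass gap above the mean-field temperature, N = 2)] -/
theorem twoPoint_nn_le_pow {K : ℝ} (hK : 0 ≤ K) {d : ℕ} (Λ : Finset (Site d)) (a c : Λ) :
    twoPoint (nnXYCoupling K d Λ) a c ≤ (d * K) ^ l1Norm ((a : Site d) - (c : Site d)) := by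
  have hJ : ∀ p : Λ × Λ, 0 ≤ nnXYCoupling K d Λ p := fun p =>
    mul_nonneg (by positivity) (nnCoupling_nonneg _ _)
  have h := twoPoint_le_pow_of_rowSum_le hJ (sum_nnXYCoupling_le hK Λ) c
    (d := fun y : Λ => l1Norm ((y : Site d) - (c : Site d))) (by simp [l1Norm]) ?_ a
  · have e : 2 * (d : ℝ) * K / 2 = d * K := by ring
    rwa [e] at h
  · intro x y hxy
    have hne : nnCoupling d (x : Site d) (y : Site d) ≠ 0 := by
      intro h0
      apply hxy
      unfold nnXYCoupling
      rw [show nnCoupling d (y : Site d) (x : Site d) = nnCoupling d (x : Site d) (y : Site d) by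
        unfold nnCoupling; rw [l1Norm_sub_comm], h0]
      ring
    have h1 : l1Norm ((x : Site d) - (y : Site d)) = 1 := by
      unfold nnCoupling at hne
      by_contra h
      exact hne (if_neg h)
    have htri := l1Norm_add_le ((x : Site d) - (y : Site d)) ((y : Site d) - (c : Site d))
    rw [sub_add_sub_cancel, h1] at htri
    simpa [add_comm] using htri

end NearestNeighbour

end PlaneRotator

end Literature.Probability.LatticeModels
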